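import Mathlib
import Summits.AtomisticToContinuum.Crystallization.Theses.ThreeConeCertificate
import Literature.Geometry.DiscreteGeometry.FlyspeckL12

/-!
# Sketch — crux-ideate stmt-AtomisticToContinuum-11959 (ExactCertificate), ideator 2, round 1

First-lemma signatures of the three crux ideas (they need not be proved here; they must elaborate).
-/

namespace Summit.AtomisticToContinuum.Crystallization.Cruxes.ExactCertificate.Sketch

open scoped BigOperators
open MeasureTheory Literature.MathematicalPhysics.StatisticalMechanics
  Literature.Geometry.DiscreteGeometry

/-! ## Idea A — spectral-floor pricing: far rigidity of positive-definite completions -/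

/-- Autocorrelation `φ ⋆ φ̃ (x) = ∫ φ(y) φ(y + x) dy` of a test function. -/
noncomputable def autocorr (φ : EuclideanSpace ℝ (Fin 3) → ℝ) (x : EuclideanSpace ℝ (Fin 3)) : ℝ :=
  ∫ y, φ y * φ (y + x)

/-- FIRST LEMMA (idea A). A finite signed measure `ν = μ₁ - μ₂` on `ℝ³` that is positive definite
(non-negative on all autocorrelations of continuous compactly supported test functions) and vanishes
on a ball around the origin is zero: the far part of a pure-point pair statistic admits no finite
positive-definite-preserving modification. -/
theorem far_modification_eq (ρ : ℝ) (hρ : 0 < ρ)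
    (μ₁ μ₂ : Measure (EuclideanSpace ℝ (Fin 3))) [IsFiniteMeasure μ₁] [IsFiniteMeasure μ₂]
    (h₁ : μ₁ (Metric.ball 0 ρ) = 0) (h₂ : μ₂ (Metric.ball 0 ρ) = 0)
    (hpd : ∀ φ : EuclideanSpace ℝ (Fin 3) → ℝ, Continuous φ → HasCompactSupport φ →
      ∫ x, autocorr φ x ∂μ₂ ≤ ∫ x, autocorr φ x ∂μ₁) :
    μ₁ = μ₂ := by
  sorry

/-! ## Idea B — the L12 column: Hales's local annulus inequality as the priced finite-range cone -/

/-- Soft version of Hales's weight `L`: `1 - K(1-h)` below contact (penalty for compressed pairs,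
slope `K`), Hales's ramp `L(h) = (1.26 - h)/0.26` on `[1, 1.26]`, zero beyond. Continuous, kink at
`h = 1` where it peaks at `1`. -/
noncomputable def softRamp (K h : ℝ) : ℝ :=
  if h < 1 then 1 - K * (1 - h) else if h ≤ 1.26 then halesL h else 0

/-- FIRST LEMMA (idea B, "soft L12"). Flyspeck's `L12` (a formally verified named fact in the tree)
plus an elementary cube-counting of compressed pairs give a GLOBAL weighted-coordination bound with
the exact constant `12` for all finite configurations, at every scale `a`. -/
theorem softL12 (hL12 : flyspeck_L12) :
    ∃ K : ℝ, 0 < K ∧ ∀ a : ℝ, 0 < a → ∀ (N : ℕ) (x : Fin N → EuclideanSpace ℝ (Fin 3)),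
      Function.Injective x →
        ∑ i, ∑ j ∈ Finset.univ.erase i, softRamp K (dist (x i) (x j) / a) ≤ 12 * (N : ℝ) := by
  sorry

/-- Certificate form of idea B: the L12 column `g = -γ · softRamp K (r/a)` is finite range
(`g = 0` on `[1.26 a, ∞)`) and `6γ`-stable, with equality at every Barlow packing of nearest-neighbour
distance `a` — an EXACT finite-range cone requiring no new local inequality. -/
theorem l12Column_stable (hL12 : flyspeck_L12) :
    ∃ K : ℝ, 0 < K ∧ ∀ a γ : ℝ, 0 < a → 0 ≤ γ → ∀ (N : ℕ) (x : Fin N → EuclideanSpace ℝ (Fin 3)),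
      Function.Injective x →
        -(6 * γ * (N : ℝ)) ≤ interactionEnergy (fun r => -γ * softRamp K (r / a)) x := by
  sorry

/-! ## Idea C — two-gap interpolation: the slack `U` must be active at all far scales -/

/-- FIRST LEMMA (idea C, a refuted strengthening that shapes the construction): there is NO exact
three-cone certificate whose slack `U` vanishes identically beyond some radius `R₁` (i.e. with
`f = V_LJ` on `[R₁, ∞)`) and whose positive-type part `f` is continuous — Paley–Wiener/Cartwright zero
density `≤ 4 R₁ T` of the entire extension of `f̂` versus `≳ T²` non-extinct Bragg radii of `P` on which
tightness forces `f̂` to vanish. Hence both gap functions of the line (space side `U`, Fourier side `ψ`)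
have unbounded support. -/
theorem farU_necessary :
    ¬ ∃ (P : PeriodicConfiguration 3) (ρ c R₁ : ℝ) (g U f : ℝ → ℝ),
      (∀ r : ℝ, 0 < r → lennardJones r = g r + U r + f r) ∧ (∀ r : ℝ, 0 < r → 0 ≤ U r) ∧
      (∀ r : ℝ, ρ ≤ r → g r = 0) ∧
      (∀ (n : ℕ) (y : Fin n → EuclideanSpace ℝ (Fin 3)) (w : Fin n → ℝ),
        0 ≤ ∑ i, ∑ j, w i * w j * f (dist (y i) (y j))) ∧
      (∀ (N : ℕ) (x : Fin N → EuclideanSpace ℝ (Fin 3)), Function.Injective x →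
        -(c * (N : ℝ)) ≤ interactionEnergy g x) ∧
      c + f 0 / 2 = -(P.energyPerParticle lennardJones) ∧
      Continuous f ∧ (∀ r : ℝ, R₁ ≤ r → U r = 0) := by
  sorry

/-- Sanity link: the clauses above are literally those of the crux plus two extra conjuncts. -/
example (h : ¬ Theses.ThreeConeCertificate.ExactCertificate) :
    ¬ ∃ (P : PeriodicConfiguration 3) (ρ c R₁ : ℝ) (g U f : ℝ → ℝ),
      (∀ r : ℝ, 0 < r → lennardJones r = g r + U r + f r) ∧ (∀ r : ℝ, 0 < r → 0 ≤ U r) ∧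
      (∀ r : ℝ, ρ ≤ r → g r = 0) ∧
      (∀ (n : ℕ) (y : Fin n → EuclideanSpace ℝ (Fin 3)) (w : Fin n → ℝ),
        0 ≤ ∑ i, ∑ j, w i * w j * f (dist (y i) (y j))) ∧
      (∀ (N : ℕ) (x : Fin N → EuclideanSpace ℝ (Fin 3)), Function.Injective x →
        -(c * (N : ℝ)) ≤ interactionEnergy g x) ∧
      c + f 0 / 2 = -(P.energyPerParticle lennardJones) ∧
      Continuous f ∧ (∀ r : ℝ, R₁ ≤ r → U r = 0) := by
  rintro ⟨P, ρ, c, R₁, g, U, f, h1, h2, h3, h4, h5, h6, -, -⟩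
  exact h ⟨P, ρ, c, g, U, f, h1, h2, h3, h4, h5, h6⟩

end Summit.AtomisticToContinuum.Crystallization.Cruxes.ExactCertificate.Sketch
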